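import Literature.MathematicalPhysics.QuantumFieldTheory.Balaban1983to89.B9Eq3132TentOverlap

/-!
# `Balaban1983to89.B9Eq3132EnergyOfTents` — T. Bałaban, *Propagators and renormalization transformations for lattice gauge theories. II*, Commun. Math. Phys. **96**
# (1984) 223–250 [Balaban1984PropagatorsII], (2.147) p. 248 with [Balaban1985BackgroundPropagators] (3.26) p. 395, (3.35) p. 396, (3.69) p. 404, (3.132) p. 422:
# THE `Δ_a(U)`-ENERGY OF THE TRANSPORTED TENT BUMPS IS BOUNDED — row 26's binder `hP1` REDUCED TO TWO LOCAL SMALLNESS FACTS ON THE BASE BLOCKS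
# (plaquettes `|U(∂p) − 1| ≤ ϖ·L^{−2j}`, lassos `|U(Γ_{x,z})U(z,z′)U(Γ_{x,z′})⁻¹ − 1| ≤ ω·L^{−j}`), uniformly in the member and in `k`

statement-level skeleton of published theorems with citation tags; proofs where landed; nothing here is a claim about the Yang–Mills mass gap

THE PRINT.  [4] p. 248: *«The operator C is an inverse to the operator of the quadratic form (2.120), hence it is bounded from below by an inverse of an upper bound of
this form … (2.147) with a positive constant γ₀ depending on d and L only»*; [B9] p. 422 (3.132) *«as in [4] (2.147)»*; p. 404 (3.69) *«Δ′ is a small perturbation of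
D\*D … the estimates follow directly from the assumptions (3.35)»*; p. 397 (3.40) (transport along shortest contours).

WHY THIS FILE (dag-n06-i gen 14, N06 bundle F4, row 26).  After `B9Eq3132CoerciveFromEnergy.hco26_of_energy_step12` (certificate ed. 12) row 26 displays ONE binder `hP1`:
`⟨TΨ, Δ_a(U)TΨ⟩₁ ≤ C‖Ψ‖²` for `T = tentOp (bumpProfile)`.  THIS FILE proves it from two LOCAL smallness facts about the background on the base blocks of the index bonds —
(hP) every plaquette with three corners in `Bʲ(base y)` has `|U(∂p) − 1| ≤ ϖ·(Lʲ)⁻²`, (hW) every taxicab lasso `U(Γ_{x₀,z})U(z,z+e_κ)U(Γ_{x₀,z+e_κ})⁻¹` with `z, z+e_κ ∈ Bʲ(base y)`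
(`x₀` = def-Y's transport origin of `y`) is within `ω·(Lʲ)⁻¹` of `1` — with `C = C(d, L, b₁, ω, ϖ)` explicit and uniform in `k` and in the member.  Ingredients:
`B9Eq3132EnergyUpper` (the form from above), `B9Eq3132TentKinetic` (one tent), the tree's homogeneity bounds `nu_sq_grad_le ∕ nu_sq_q_le` and overlap counts
`card_bump_support_le ∕ card_pair_support_le ∕ qrow`, and the forward closure of the tree's bumps (`tauL_last`).  (hP)∕(hW) follow from (3.35) by n06-j's
`B9Eq335PlaquetteAtLettersY` and this seat's ladder files on the member's cube class — the sequel; here they are DISPLAYED, so the theorem is also usable verbatim at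
any typed class of backgrounds.

WHAT IS PROVED (sorry-free).
* (parts 3–4, `B9Eq3132TentBumps` ∕ `B9Eq3132TentOverlap`: the bumps as profiles with their homogeneity bounds; overlaps; the flat `Q(U)`-term.)
* §4 `BaseLassoSmall` (hW), `BasePlaqSmall` (hP), `curl_part_le`, `div_part_le`, `edge_part_le`, `Cp1`, ★★★ `energy_tentOp_le` — at a k-level index, `G ≤ U(N)`, `U` `G`-valued with (hP), (hW): `⟨TΨ, Δ_a(U)TΨ⟩₁ ≤ Cp1 d ℓ b₁ ω ϖ · ⟨Ψ, Ψ⟩₁`.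
* §5 ★★★ `hP1_of_transport` — the certificate's `hP1` (shape of `B9Eq3132CoerciveFromEnergy.hco26_of_energy_step12`, verbatim) from ONE displayed binder `hWP`: (hP) ∧ (hW) for
  the member's (3.35)-class with member-uniform `ω, ϖ` below a threshold `M·α₀ ≤ aT`.

HONEST SCOPE.  Finite-dimensional estimates over def-Y's letters and the tree's [4]-machinery; (hP)∕(hW) are hypotheses here (printed-type: (3.69)'s plaquette bound on
`Ω_j` and the transport regularity behind (3.40)); row 17's `hΔA` untouched; nothing of [B9] asserted; count-neutral; N06 NOT discharged.  Cell `pub-ymgap` (HUMAN RULING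
D-0062), Track A node N06 [B9], seat `pub-ymgap-dag-n06-i` (gen 14), 2026-08-27; a NEW file.
-/

noncomputable section

namespace Literature.MathematicalPhysics.QuantumFieldTheory.Balaban1983to89.B9Eq3132EnergyOfTents

open Node00
open B6KLevelCensusIndexV1 (KIdx)
open B6GlobalChartV1 (PV domT)
open B6Ineq2142KLevelV1 (lvl base qwt qwt_nonneg)
open B5Eq118OneStroke (iterBlock mem_iterBlock)
open B15DeterminingSets (embIter)
open B9Eq39Adjoint (R R_add R_sub R_mul R_one R_smul R_zero)
open B9Thm311ReadingCoords (trIP trIP_eq_re_trace)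
open B9Ineq369CurvatureSmallAtLettersY (hs_nonneg hs_R_le trIP_one_self_eq norm_weight_eq)
open B9Thm311PosOfPrincipalAtLettersY (norm_reHolY_sub_one_le norm_imHolY_le)
open B9Eq3132NuReading (lamY lamY_pos)
open B9Eq3132TentOperator (tentOp QY_tentOp_apply eWt)
open B9Eq3132TentCurl (tentField curlY_tentField divY_tentField tentOp_summand_eq_tentField)
open B9Eq3132ApproxRightInverse (bumpProfile bumpProfile_nonneg two_le_sitesPerDir mass_pos' wt_eq_lamY_sq eWt_bumpProfile)
open B9Thm311FlippedBondLetters (hs_real_smul)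
open B9Eq3132TentFlat (pdiff gradSq massSq gradSq_nonneg massSq_nonneg hs_sum_le_card_support_mul hs_sum_le_card_mul)
open B9Eq3132TentKinetic (contractive_of_mem lasso_mem_unitary sum_hs_curlY_tentField_le sum_hs_divY_tentField_le sum_weight_edge_le hs_tentField_le)
open B6QGQTestBumpsKLevelV1 (bump bump_ne_zero_imp rad loc card_bump_support_le card_pair_support_le)
open B6QGQCoerciveKLevelV1 (mass nu Cgrad tauL_last tauL_le_rad shift_mem_iff Adens Adens_nonneg bump_eq_of_mem sum_Adens_long TT2 TT2_le tsumL_ge Tsum_ge mass_mul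
  nu_sq_grad_le nu_sq_q_le hwup_of_globalBand)
open B6Prop27KLevelV1 (wt wt_pos)
open B9GeoLemma21KLevelV1 (one_le_k)
open B9Eq3132Ineq2142Covariant (two_le_RMh)
open scoped Matrix Matrix.Norms.L2Operator
open B9Eq3132TentBumps (baseBlk orgY sideY sideY_pos bumpProfile_src_mem bumpProfile_fwd gradSq_hom massSq_hom cf_sq_mul_lamY_sq Cth)
open B9Eq3132TentOverlap (tentOp_eq_sum_tentField hs_tentOp_le hs_curlY_tentOp_le hs_divY_tentOp_le trIP_QY_tentOp_le CQ)

variable {N : ℕ} {d ℓ : ℕ} {hd : 1 ≤ d + 1} {hL : Odd (ℓ + 1) ∧ 1 < ℓ + 1} {b₀ b₁ : ℝ} (i : KIdx d ℓ hd hL b₀ b₁)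

/-! ## §4 ★★★ The energy of the transported tent bumps -/

section Energy

variable {G : Subgroup (Matrix (Fin N) (Fin N) ℂ)ˣ} (hG : G ≤ B7Prop2Explicit.unitaryUnits (Matrix (Fin N) (Fin N) ℂ))
variable {U : CfgY (Matrix (Fin N) (Fin N) ℂ) i} (hU : ∀ μ x, U μ x ∈ G)

/-- the interior-lasso hypothesis (hW) at a k-level index: every taxicab lasso with both ends in a base block is within `ω·(Lʲ)⁻¹` of `1`.
[cite: Balaban1985BackgroundPropagators, (3.40) p.397, (3.35) p.396] -/
def BaseLassoSmall (U : CfgY (Matrix (Fin N) (Fin N) ℂ) i) (ω : ℝ) : Prop :=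
  ∀ (y : IBondY i) (z : Site (PV d ℓ i.m i.K hd hL) 0) (κ : Fin (PV d ℓ i.m i.K hd hL).d), z ∈ baseBlk i y → z.shift κ ∈ baseBlk i y →
    ‖((parBY i U (orgY i y) z * U κ z * (parBY i U (orgY i y) (z.shift κ))⁻¹ : (Matrix (Fin N) (Fin N) ℂ)ˣ) : Matrix (Fin N) (Fin N) ℂ) - 1‖ ≤ ω * (sideY i y)⁻¹

/-- the base-block plaquette hypothesis (hP) at a k-level index: every plaquette with three corners in a base block has `|U(∂p) − 1| ≤ ϖ·(Lʲ)⁻²`.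
[cite: Balaban1985BackgroundPropagators, (3.69) p.404, (3.35) p.396] -/
def BasePlaqSmall (U : CfgY (Matrix (Fin N) (Fin N) ℂ) i) (ϖ : ℝ) : Prop :=
  ∀ (y : IBondY i) (p : PlaqY i), p.src ∈ baseBlk i y → p.src.shift p.μ ∈ baseBlk i y → p.src.shift p.ν ∈ baseBlk i y →
    ‖((holY i U p : (Matrix (Fin N) (Fin N) ℂ)ˣ) : Matrix (Fin N) (Fin N) ℂ) - 1‖ ≤ ϖ * (sideY i y)⁻¹ ^ 2

/-- unfolding (hW). [cite: Balaban1985BackgroundPropagators, (3.40) p.397, bookkeeping] -/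
theorem baseLassoSmall_iff (U : CfgY (Matrix (Fin N) (Fin N) ℂ) i) (ω : ℝ) : BaseLassoSmall i U ω ↔
    ∀ (y : IBondY i) (z : Site (PV d ℓ i.m i.K hd hL) 0) (κ : Fin (PV d ℓ i.m i.K hd hL).d), z ∈ baseBlk i y → z.shift κ ∈ baseBlk i y →
      ‖((parBY i U (orgY i y) z * U κ z * (parBY i U (orgY i y) (z.shift κ))⁻¹ : (Matrix (Fin N) (Fin N) ℂ)ˣ) : Matrix (Fin N) (Fin N) ℂ) - 1‖ ≤ ω * (sideY i y)⁻¹ :=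
  Iff.rfl

/-- unfolding (hP). [cite: Balaban1985BackgroundPropagators, (3.69) p.404, bookkeeping] -/
theorem basePlaqSmall_iff (U : CfgY (Matrix (Fin N) (Fin N) ℂ) i) (ϖ : ℝ) : BasePlaqSmall i U ϖ ↔
    ∀ (y : IBondY i) (p : PlaqY i), p.src ∈ baseBlk i y → p.src.shift p.μ ∈ baseBlk i y → p.src.shift p.ν ∈ baseBlk i y →
      ‖((holY i U p : (Matrix (Fin N) (Fin N) ℂ)ˣ) : Matrix (Fin N) (Fin N) ℂ) - 1‖ ≤ ϖ * (sideY i y)⁻¹ ^ 2 :=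
  Iff.rfl

/-- `HS(Λ_yΨ(y)) = Λ_y²HS(Ψ(y))`. [cite: Balaban1984PropagatorsII, (2.81) p.237, bookkeeping] -/
theorem hs_lam_smul (y : IBondY i) (Ψ : IBondY i → Matrix (Fin N) (Fin N) ℂ) :
    ∑ a, ∑ c, ‖(lamY i y • Ψ y) a c‖ ^ 2 = lamY i y ^ 2 * ∑ a, ∑ c, ‖Ψ y a c‖ ^ 2 := by rw [← Complex.coe_smul, hs_real_smul]

include hG hU

/-- ★ **THE CURL PART**: `Σ_p HS((D_U T_θΨ)(p)) ≤ 8(d+1)(20C_∇ + 64(d+1)ω²C_Θ)·‖Ψ‖²`. [cite: Balaban1985BackgroundPropagators, (3.4) p.391, (3.40) p.397; Balaban1984PropagatorsII, (2.147) p.248] -/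
theorem curl_part_le {ω : ℝ} (hW : BaseLassoSmall i U ω) (Ψ : IBondY i → Matrix (Fin N) (Fin N) ℂ) :
    ∑ p : PlaqY i, ∑ a, ∑ c, ‖curlY i U (tentOp i (bumpProfile i) U Ψ) p a c‖ ^ 2 ≤
      (8 * ((d : ℝ) + 1)) * (20 * Cgrad d + 64 * (d + 1) * ω ^ 2 * Cth d) * trIP (fun _ => (1 : ℝ)) Ψ Ψ := by
  have hU' : ∀ μ x, U μ x ∈ B7Prop2Explicit.unitaryUnits (Matrix (Fin N) (Fin N) ℂ) := fun μ x => hG (hU μ x)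
  refine (Finset.sum_le_sum fun p _ => hs_curlY_tentOp_le i Ψ p).trans ?_
  rw [← Finset.mul_sum, Finset.sum_comm, trIP_one_self_eq, mul_assoc (8 * ((d : ℝ) + 1))]
  refine mul_le_mul_of_nonneg_left (α := ℝ) ?_ (by positivity)
  rw [Finset.mul_sum]
  refine Finset.sum_le_sum fun y _ => ?_
  have h := sum_hs_curlY_tentField_le i hU' (bumpProfile i y) (bumpProfile_nonneg i y) (baseBlk i y) (fun f hf => (bumpProfile_src_mem i y hf).2)
    (orgY i y) (lamY i y • Ψ y) (ϑ := ω * (sideY i y)⁻¹) (fun z κ hz hz' => hW y z κ hz hz')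
  rw [hs_lam_smul] at h
  refine h.trans ?_
  have hg := gradSq_hom i y
  have hm := massSq_hom i y
  have hΨ := hs_nonneg (Ψ y)
  have e : i.cf ^ 2 * (lamY i y ^ 2 * ∑ a, ∑ c, ‖Ψ y a c‖ ^ 2) * (20 * gradSq i (bumpProfile i y) + 64 * (d + 1) * (ω * (sideY i y)⁻¹) ^ 2 * massSq i (bumpProfile i y)) =
      (20 * (i.cf ^ 2 * lamY i y ^ 2 * gradSq i (bumpProfile i y)) + 64 * (d + 1) * ω ^ 2 * (i.cf ^ 2 * lamY i y ^ 2 * (sideY i y)⁻¹ ^ 2 * massSq i (bumpProfile i y))) *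
        ∑ a, ∑ c, ‖Ψ y a c‖ ^ 2 := by ring
  rw [e]
  refine mul_le_mul_of_nonneg_right ?_ hΨ
  have h4 : 64 * ((d : ℝ) + 1) * ω ^ 2 * (i.cf ^ 2 * lamY i y ^ 2 * (sideY i y)⁻¹ ^ 2 * massSq i (bumpProfile i y)) ≤ 64 * ((d : ℝ) + 1) * ω ^ 2 * Cth d :=
    mul_le_mul_of_nonneg_left hm (by positivity)
  linarith

/-- ★ **THE DIVERGENCE PART**: `⟨D\*_U T_θΨ, D\*_U T_θΨ⟩₁ ≤ 4(d+1)³(10C_∇ + 16ω²C_Θ)·‖Ψ‖²`. [cite: Balaban1985BackgroundPropagators, (3.8) p.392, (3.40) p.397; Balaban1984PropagatorsII, (2.147) p.248] -/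
theorem div_part_le {ω : ℝ} (hW : BaseLassoSmall i U ω) (Ψ : IBondY i → Matrix (Fin N) (Fin N) ℂ) :
    trIP (fun _ => (1 : ℝ)) (divY i U (tentOp i (bumpProfile i) U Ψ)) (divY i U (tentOp i (bumpProfile i) U Ψ)) ≤
      (4 * ((d : ℝ) + 1) ^ 2) * (((d : ℝ) + 1) * (10 * Cgrad d + 16 * ω ^ 2 * Cth d)) * trIP (fun _ => (1 : ℝ)) Ψ Ψ := by
  have hU' : ∀ μ x, U μ x ∈ B7Prop2Explicit.unitaryUnits (Matrix (Fin N) (Fin N) ℂ) := fun μ x => hG (hU μ x)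
  rw [trIP_one_self_eq]
  refine (Finset.sum_le_sum fun s _ => hs_divY_tentOp_le i Ψ s).trans ?_
  rw [← Finset.mul_sum, Finset.sum_comm, trIP_one_self_eq, mul_assoc (4 * ((d : ℝ) + 1) ^ 2)]
  refine mul_le_mul_of_nonneg_left (α := ℝ) ?_ (by positivity)
  rw [Finset.mul_sum]
  refine Finset.sum_le_sum fun y _ => ?_
  have h := sum_hs_divY_tentField_le i hU' (bumpProfile i y) (bumpProfile_nonneg i y) (baseBlk i y) (fun f hf => (bumpProfile_src_mem i y hf).2)
    (orgY i y) (lamY i y • Ψ y) (ϑ := ω * (sideY i y)⁻¹) (fun z κ hz hz' => hW y z κ hz hz')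
  rw [hs_lam_smul] at h
  refine h.trans ?_
  have hg := gradSq_hom i y
  have hm := massSq_hom i y
  have hΨ := hs_nonneg (Ψ y)
  have e : ((d : ℝ) + 1) * i.cf ^ 2 * (lamY i y ^ 2 * ∑ a, ∑ c, ‖Ψ y a c‖ ^ 2) * (10 * gradSq i (bumpProfile i y) + 16 * (ω * (sideY i y)⁻¹) ^ 2 * massSq i (bumpProfile i y)) =
      ((d : ℝ) + 1) * (10 * (i.cf ^ 2 * lamY i y ^ 2 * gradSq i (bumpProfile i y)) + 16 * ω ^ 2 * (i.cf ^ 2 * lamY i y ^ 2 * (sideY i y)⁻¹ ^ 2 * massSq i (bumpProfile i y))) *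
        ∑ a, ∑ c, ‖Ψ y a c‖ ^ 2 := by ring
  rw [e]
  refine mul_le_mul_of_nonneg_right (mul_le_mul_of_nonneg_left (α := ℝ) ?_ (by positivity)) hΨ
  have h4 : 16 * ω ^ 2 * (i.cf ^ 2 * lamY i y ^ 2 * (sideY i y)⁻¹ ^ 2 * massSq i (bumpProfile i y)) ≤ 16 * ω ^ 2 * Cth d :=
    mul_le_mul_of_nonneg_left hm (by positivity)
  linarith

/-- ★ **THE CURVATURE EDGE PART**: `Σ_p c_f²|Im U(∂p)|·Σ_m HS((T_θΨ)(b_m p)) ≤ 2(d+1)(2C_∇ + 4(d+1)ϖC_Θ)·‖Ψ‖² (crude weight `2c_f²` on boundary plaquettes, `c_f²ϖ(Lʲ)⁻²`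
on plaquettes cornered in the base block). [cite: Balaban1985BackgroundPropagators, (3.69) p.404, (3.10) p.392; Balaban1984PropagatorsII, (2.147) p.248] -/
theorem edge_part_le {ϖ : ℝ} (hϖ : 0 ≤ ϖ) (hP : BasePlaqSmall i U ϖ) (Ψ : IBondY i → Matrix (Fin N) (Fin N) ℂ) :
    ∑ p : PlaqY i, i.cf ^ 2 * ‖imHolY i U p‖ * ∑ m : Fin 4, ∑ a, ∑ c, ‖tentOp i (bumpProfile i) U Ψ (edgeY i p m) a c‖ ^ 2 ≤
      (2 * ((d : ℝ) + 1)) * (2 * Cgrad d + 4 * (d + 1) * ϖ * Cth d) * trIP (fun _ => (1 : ℝ)) Ψ Ψ := by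
  have hU' : ∀ μ x, U μ x ∈ B7Prop2Explicit.unitaryUnits (Matrix (Fin N) (Fin N) ℂ) := fun μ x => hG (hU μ x)
  have hUu : ∀ μ x, ((U μ x : (Matrix (Fin N) (Fin N) ℂ)ˣ) : Matrix (Fin N) (Fin N) ℂ) ∈ unitary (Matrix (Fin N) (Fin N) ℂ) := hU'
  -- the crude plaquette bound `|U(∂p) − 1| ≤ 2`
  have hcrude : ∀ p : PlaqY i, ‖((holY i U p : (Matrix (Fin N) (Fin N) ℂ)ˣ) : Matrix (Fin N) (Fin N) ℂ) - 1‖ ≤ 2 := by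
    intro p
    have h1 := (contractive_of_mem (B9Thm311AdjointPairs.holY_mem_unitary i U hUu p)).1
    have h2 := (contractive_of_mem (Subgroup.one_mem (B7Prop2Explicit.unitaryUnits (Matrix (Fin N) (Fin N) ℂ)))).1
    rw [Units.val_one] at h2
    calc _ ≤ ‖((holY i U p : (Matrix (Fin N) (Fin N) ℂ)ˣ) : Matrix (Fin N) (Fin N) ℂ)‖ + ‖(1 : Matrix (Fin N) (Fin N) ℂ)‖ := norm_sub_le _ _
      _ ≤ 2 := by linarith
  -- overlap on the edges, then one tent at a time
  have step : ∀ p : PlaqY i, i.cf ^ 2 * ‖imHolY i U p‖ * ∑ m : Fin 4, ∑ a, ∑ c, ‖tentOp i (bumpProfile i) U Ψ (edgeY i p m) a c‖ ^ 2 ≤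
      (2 * ((d : ℝ) + 1)) * ∑ y, (i.cf ^ 2 * ‖imHolY i U p‖) * ∑ m : Fin 4, ∑ a, ∑ c, ‖tentField i (bumpProfile i y) (orgY i y) U (lamY i y • Ψ y) (edgeY i p m) a c‖ ^ 2 := by
    intro p
    have h := Finset.sum_le_sum fun m (_ : m ∈ (Finset.univ : Finset (Fin 4))) => hs_tentOp_le i (U := U) Ψ (edgeY i p m)
    rw [← Finset.mul_sum, Finset.sum_comm (s := (Finset.univ : Finset (Fin 4))) (t := (Finset.univ : Finset (IBondY i)))] at h
    calc _ ≤ i.cf ^ 2 * ‖imHolY i U p‖ * ((2 * ((d : ℝ) + 1)) * ∑ y, ∑ m : Fin 4, ∑ a, ∑ c, ‖tentField i (bumpProfile i y) (orgY i y) U (lamY i y • Ψ y) (edgeY i p m) a c‖ ^ 2) :=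
          mul_le_mul_of_nonneg_left (α := ℝ) h (by positivity)
      _ = _ := by rw [Finset.mul_sum, Finset.mul_sum, Finset.mul_sum]; exact Finset.sum_congr rfl fun y _ => by ring
  refine (Finset.sum_le_sum fun p _ => step p).trans ?_
  rw [← Finset.mul_sum, Finset.sum_comm, trIP_one_self_eq, mul_assoc (2 * ((d : ℝ) + 1))]
  refine mul_le_mul_of_nonneg_left (α := ℝ) ?_ (by positivity)
  rw [Finset.mul_sum]
  refine Finset.sum_le_sum fun y _ => ?_
  have h := sum_weight_edge_le i hU' (bumpProfile i y) (bumpProfile_nonneg i y) (baseBlk i y) (fun f hf => (bumpProfile_src_mem i y hf).2)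
    (fun f hf => bumpProfile_fwd i y hf) (orgY i y) (lamY i y • Ψ y) (fun p => i.cf ^ 2 * ‖imHolY i U p‖) (w₀ := 2 * i.cf ^ 2) (w₁ := i.cf ^ 2 * (ϖ * (sideY i y)⁻¹ ^ 2))
    (fun p => by positivity) (fun p => by have := norm_imHolY_le i U hUu (hcrude p); nlinarith [sq_nonneg i.cf])
    (fun p h1 h2 h3 => mul_le_mul_of_nonneg_left (norm_imHolY_le i U hUu (hP y p h1 h2 h3)) (sq_nonneg _)) (by positivity) (by positivity)
  rw [hs_lam_smul] at h
  refine h.trans ?_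
  have hg := gradSq_hom i y
  have hm := massSq_hom i y
  have hΨ := hs_nonneg (Ψ y)
  have e : lamY i y ^ 2 * (∑ a, ∑ c, ‖Ψ y a c‖ ^ 2) * (2 * i.cf ^ 2 * gradSq i (bumpProfile i y) + 4 * (d + 1) * (i.cf ^ 2 * (ϖ * (sideY i y)⁻¹ ^ 2)) * massSq i (bumpProfile i y)) =
      (2 * (i.cf ^ 2 * lamY i y ^ 2 * gradSq i (bumpProfile i y)) + 4 * (d + 1) * ϖ * (i.cf ^ 2 * lamY i y ^ 2 * (sideY i y)⁻¹ ^ 2 * massSq i (bumpProfile i y))) *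
        ∑ a, ∑ c, ‖Ψ y a c‖ ^ 2 := by ring
  rw [e]
  refine mul_le_mul_of_nonneg_right ?_ hΨ
  have h4 : 4 * ((d : ℝ) + 1) * ϖ * (i.cf ^ 2 * lamY i y ^ 2 * (sideY i y)⁻¹ ^ 2 * massSq i (bumpProfile i y)) ≤ 4 * ((d : ℝ) + 1) * ϖ * Cth d :=
    mul_le_mul_of_nonneg_left hm (by positivity)
  linarith

/-- the (P′1) constant `C(d, L, b₁, ω, ϖ)`. [cite: Balaban1984PropagatorsII, (2.147) p.248, bookkeeping ours] -/
def Cp1 (d ℓ : ℕ) (b₁ ω ϖ : ℝ) : ℝ :=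
  3 * ((8 * ((d : ℝ) + 1)) * (20 * Cgrad d + 64 * (d + 1) * ω ^ 2 * Cth d))
    + 3 * ((2 * ((d : ℝ) + 1)) * (2 * Cgrad d + 4 * (d + 1) * ϖ * Cth d))
    + (4 * ((d : ℝ) + 1) ^ 2) * (((d : ℝ) + 1) * (10 * Cgrad d + 16 * ω ^ 2 * Cth d))
    + CQ d ℓ b₁

omit hG hU i in
/-- `C > 0`. [cite: Balaban1984PropagatorsII, (2.147) p.248, bookkeeping] -/
theorem Cp1_pos (d ℓ : ℕ) {b₁ ω ϖ : ℝ} (hb₁ : 0 ≤ b₁) (hϖ : 0 ≤ ϖ) : 0 < Cp1 d ℓ b₁ ω ϖ := by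
  unfold Cp1 CQ Cgrad Cth; positivity

/-- ★★★ **THE `Δ_a(U)`-ENERGY OF THE TRANSPORTED TENT BUMPS**: at a k-level index, for a `G`-valued background (`G ≤ U(N)`) whose lassos and plaquettes are small on the
base blocks ((hW) with `ω`, (hP) with `ϖ ≥ 0`), `⟨T_θΨ, Δ_a(U)T_θΨ⟩₁ ≤ C(d, L, b₁, ω, ϖ)·⟨Ψ, Ψ⟩₁` for `T_θ = tentOp (bumpProfile)` — uniformly in `k` and in the member.
[cite: Balaban1984PropagatorsII, (2.147) p.248; Balaban1985BackgroundPropagators, (3.26) p.395, (3.69) p.404, (3.132) p.422] -/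
theorem energy_tentOp_le (hb₁ : 0 ≤ b₁) {ω ϖ : ℝ} (hϖ : 0 ≤ ϖ) (hW : BaseLassoSmall i U ω) (hP : BasePlaqSmall i U ϖ)
    (Ψ : IBondY i → Matrix (Fin N) (Fin N) ℂ) :
    trIP (fun _ => (1 : ℝ)) (tentOp i (bumpProfile i) U Ψ)
        (deltaAY i (parSymY i) (parBY i) (GpY i (parSymY i)) U (tentOp i (bumpProfile i) U Ψ)) ≤ Cp1 d ℓ b₁ ω ϖ * trIP (fun _ => (1 : ℝ)) Ψ Ψ := by
  have hU' : ∀ μ x, U μ x ∈ B7Prop2Explicit.unitaryUnits (Matrix (Fin N) (Fin N) ℂ) := fun μ x => hG (hU μ x)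
  have hUu : ∀ μ x, ((U μ x : (Matrix (Fin N) (Fin N) ℂ)ˣ) : Matrix (Fin N) (Fin N) ℂ) ∈ unitary (Matrix (Fin N) (Fin N) ℂ) := hU'
  set A := tentOp i (bumpProfile i) U Ψ
  have h0 := B9Eq3132EnergyUpper.trIP_deltaAY_parSymY_le i hG hU A
  -- the Jordan weight is at most `3`
  have hJ : ∑ p : PlaqY i, (1 + ‖reHolY i U p - 1‖) * ∑ a, ∑ c, ‖curlY i U A p a c‖ ^ 2 ≤ 3 * ∑ p : PlaqY i, ∑ a, ∑ c, ‖curlY i U A p a c‖ ^ 2 := by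
    rw [Finset.mul_sum]
    refine Finset.sum_le_sum fun p _ => mul_le_mul_of_nonneg_right ?_ (hs_nonneg _)
    have h1 := (contractive_of_mem (B9Thm311AdjointPairs.holY_mem_unitary i U hUu p)).1
    have h2 := (contractive_of_mem (Subgroup.one_mem (B7Prop2Explicit.unitaryUnits (Matrix (Fin N) (Fin N) ℂ)))).1
    rw [Units.val_one] at h2
    have hc : ‖((holY i U p : (Matrix (Fin N) (Fin N) ℂ)ˣ) : Matrix (Fin N) (Fin N) ℂ) - 1‖ ≤ 2 :=
      (norm_sub_le _ _).trans (by linarith)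
    linarith [norm_reHolY_sub_one_le i U hUu hc]
  have h1 := curl_part_le i hG hU hW Ψ
  have h2 := edge_part_le i hG hU hϖ hP Ψ
  have h3 := div_part_le i hG hU hW Ψ
  have h4 := trIP_QY_tentOp_le i hU' hb₁ Ψ
  have hΨ : 0 ≤ trIP (fun _ => (1 : ℝ)) Ψ Ψ := by rw [trIP_one_self_eq]; exact Finset.sum_nonneg fun _ _ => hs_nonneg _
  rw [Cp1]
  nlinarith [hJ, h0]

end Energy

/-! ## §5 ★★★ Row 26's binder `hP1` from ONE displayed transport-smallness binder -/

section Member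

open B9PinMembersKLevelV1 (MemberY geo9Y bg9Y)
open B7Prop2SpecialUnitary (specialUnitaryUnits specialUnitaryUnits_le_unitaryUnits)

/-- ★★★ **ROW 26's `hP1` (the shape displayed by `B9Eq3132CoerciveFromEnergy.hco26_of_energy_step12`, VERBATIM) FROM ONE DISPLAYED BINDER `hWP`**: if, below a
threshold `M·α₀ ≤ aT`, every (3.35)-regular background of every member has its taxicab lassos on the base blocks within `ω(Lʲ)⁻¹` of `1` and its base-block plaquettes within
`ϖ(Lʲ)⁻²` of `1` (member-uniform `ω`, `ϖ`), then the `Δ_a(U)`-energy of the transported tent bumps is bounded by `C(d, L, b₁, ω, ϖ)·‖Ψ‖²`.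
[cite: Balaban1984PropagatorsII, (2.147) p.248; Balaban1985BackgroundPropagators, (3.132) p.422, (3.35) p.396, (3.69) p.404] -/
theorem hP1_of_transport (θ : Stage3Params) (Mstar : ℕ) {c35 : ℝ}
    (hWP : ∃ aT ω ϖ : ℝ, 0 < aT ∧ 0 ≤ ϖ ∧
      ∀ x : MemberY θ.d₆ θ.ℓ₆ θ.hd' θ.hL' θ.b₀ θ.b₁ Mstar, ∀ α₀ : ℝ, 0 < α₀ → (geo9Y x).M * α₀ ≤ aT →
        ∀ U : (bg9Y (Matrix (Fin N) (Fin N) ℂ) (specialUnitaryUnits (Fin N)) x).Cfg,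
          (bg9Y (Matrix (Fin N) (Fin N) ℂ) (specialUnitaryUnits (Fin N)) x).Reg335 c35 α₀ U → BaseLassoSmall x.toKIdx U ω ∧ BasePlaqSmall x.toKIdx U ϖ) :
    ∃ Mt aT C : ℝ, 0 < Mt ∧ 0 < aT ∧ 0 < C ∧
      ∀ x : MemberY θ.d₆ θ.ℓ₆ θ.hd' θ.hL' θ.b₀ θ.b₁ Mstar, Mt ≤ (geo9Y x).M → ∀ α₀ : ℝ, 0 < α₀ → (geo9Y x).M * α₀ ≤ aT →
        ∀ U : (bg9Y (Matrix (Fin N) (Fin N) ℂ) (specialUnitaryUnits (Fin N)) x).Cfg,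
          (bg9Y (Matrix (Fin N) (Fin N) ℂ) (specialUnitaryUnits (Fin N)) x).Reg335 c35 α₀ U → (bg9Y (Matrix (Fin N) (Fin N) ℂ) (specialUnitaryUnits (Fin N)) x).Reg336 c35 α₀ U →
            ∀ Ψ : IBondY x.toKIdx → Matrix (Fin N) (Fin N) ℂ,
              trIP (fun _ => (1 : ℝ)) (tentOp x.toKIdx (bumpProfile x.toKIdx) U Ψ)
                  (deltaAY x.toKIdx (parSymY x.toKIdx) (parBY x.toKIdx) (GpY x.toKIdx (parSymY x.toKIdx)) U (tentOp x.toKIdx (bumpProfile x.toKIdx) U Ψ)) ≤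
                C * trIP (fun _ => (1 : ℝ)) Ψ Ψ := by
  obtain ⟨aT, ω, ϖ, haT, hϖ, h⟩ := hWP
  have hb₁ : 0 ≤ θ.b₁ := le_trans θ.hb.1.le θ.hb.2
  refine ⟨1, aT, Cp1 θ.d₆ θ.ℓ₆ θ.b₁ ω ϖ, one_pos, haT, Cp1_pos θ.d₆ θ.ℓ₆ hb₁ hϖ, fun x _ α₀ hα hMa U h335 _ Ψ => ?_⟩
  obtain ⟨hW, hP⟩ := h x α₀ hα hMa U h335
  exact energy_tentOp_le x.toKIdx (specialUnitaryUnits_le_unitaryUnits (n := Fin N))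
    (fun μ z => B9BackgroundsKLevelV1.mem_of_reg335 x.toKIdx h335.1 μ z) hb₁ hϖ hW hP Ψ

end Member

end Literature.MathematicalPhysics.QuantumFieldTheory.Balaban1983to89.B9Eq3132EnergyOfTents

end
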